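import Mathlib
import HarnessLib

/-!
# MixedPowerCostExponent — how to read a two-spacing cost exponent of a MIXED power law: it lies
# between the smallest and the largest power present; against a steeper competitor there is at
# most one crossover (E7's continuum strategy `Eff ∝ k₀ a⁻³ + k₁ a⁻²`, row 19's deliverable)

HONEST FRAMING: exact (Metropolis-corrected) sampling algorithms for lattice gauge theory;
figures of merit are autocorrelation/cost numbers at stated couplings and volumes; no
continuum-physics claim.

Venture `LatticeQCDFlow` (cell pub-lqcd), topic `Scaling`; FANOUT row 19 (`su2-snf`, GEN-4;
deliverable "exponent of cost vs `a` at fixed ESS (SU(2) version of arXiv:2510.25704 p15)").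
OUR WORK, elementary real analysis (`Real.rpow`, `Real.log` monotonicity); nothing is cited as a
fact.  The printed STRATEGY this reads (Bonanno et al., arXiv:2510.25704 §5, eq. (5.1)–(5.2)):
keep the ESS fixed by `n_step ∝ (L_d/a)³ ∝ a⁻³` and `τ_int(Q_L²)` fixed by `n_between ∝ a⁻²`, so
the effective cost is a SUM of powers, `Eff(Q_L²) ∼ Var(Q_L²)(k₀ a⁻³ + k₁ a⁻²)`, with
architecture-dependent amplitudes (`k₀` smaller for better flows).  Row 19 measures this law at
three spacings and fits ONE exponent (`Scoring/ScalingExponentFit` types the fit itself).  What a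
single fitted exponent of a mixed law CAN be is settled here, value-free.

## Content (all proved; `mixedPowerCost s k p x = Σ_{i∈s} k_i x^{p_i}`, `x = 1/a > 0`;
## `secantExponent C x₁ x₂ = log(C x₂/C x₁)/log(x₂/x₁)`, the two-point log–log slope)

* `mixedPowerCost_le` / `le_mixedPowerCost` — refining the scale by `r = x₂/x₁ ≥ 1` multiplies a
  mixed cost with non-negative amplitudes by a factor in `[r^{pmin}, r^{pmax}]` (termwise);
* **`secantExponent_mem_Icc`** — hence EVERY TWO-SPACING EXPONENT LIES IN `[pmin, pmax]`;
  `secantExponent_pure` (a pure power returns its power exactly); contrapositive, in words: a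
  two-spacing exponent OUTSIDE the bracket certifies that the amplitudes are not
  spacing-independent (for family C: `k′(β)` drifts — E7's residual `K(β)`, row 19's `k′_W(2.50)`
  vs `k′_W(2.60)` — or the defect's physical size was not held fixed);
* `mixedPowerCost_div_antitoneOn`, **`mixedPowerCost_le_competitor_of_le`** — against a competitor
  `A x^q` with `q ≥ pmax` the cost RATIO is antitone in `x`: AT MOST ONE CROSSOVER, and past it
  the mixed law stays cheaper at every finer spacing;
* the E7 / row 19 instances: `secantExponent_two_terms_mem_Icc` (two terms),
  **`e7_secantExponent_stepUnits`** (`k₀x³ + k₁x²`: exponent in `[2, 3]` in protocol-step units),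
  **`e7_secantExponent_linkUnits`** (at fixed physical volume every step / `n_between` sweep is a
  full-lattice sweep `∝ x⁴`: `k₀x⁷ + k₁x⁶`, exponent in `[6, 7]` in link-update = core-second
  units), `e7_le_competitor_of_le` (a local algorithm with `τ_int(Q²) ∝ a^{−z}`, `z ≥ 3`, i.e.
  `q = 4 + z ≥ 7`, is overtaken once and for all).

NOT CLAIMED: that the SU(2)/SU(3) costs follow the mixed law with constant amplitudes (E7 itself
flags the residual `β`-dependence of `k′`), any value of `k₀, k₁, z`, anything about three-point
fits beyond the pairwise brackets, or which algorithm is cheaper at any given spacing.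
-/

namespace Summit.Ventures.LatticeQCDFlow.Scaling

open Finset Real

variable {ι : Type*}

/-- A MIXED POWER-LAW COST in the inverse lattice spacing `x = 1/a` (or any scale variable):
`C(x) = Σ_{i∈s} k_i · x^{p_i}` with real exponents `p_i` and amplitudes `k_i` (`x^p = Real.rpow`). -/
noncomputable def mixedPowerCost (s : Finset ι) (k p : ι → ℝ) (x : ℝ) : ℝ :=
  ∑ i ∈ s, k i * x ^ (p i)

/-- The two-point (secant, log–log) exponent of a cost between scales `x₁` and `x₂`:
`log(C x₂ / C x₁) / log(x₂ / x₁)` — what a fit through two lattice spacings returns. -/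
noncomputable def secantExponent (C : ℝ → ℝ) (x₁ x₂ : ℝ) : ℝ :=
  Real.log (C x₂ / C x₁) / Real.log (x₂ / x₁)

section Bracket

variable (s : Finset ι) {k p : ι → ℝ} {pmin pmax x₁ x₂ : ℝ}

/-- One term between two scales: `k x₂^p = (x₂/x₁)^p · (k x₁^p)`. -/
theorem term_eq_ratio_rpow_mul (k p : ℝ) (hx₁ : 0 < x₁) (hx₂ : 0 < x₂) :
    k * x₂ ^ p = (x₂ / x₁) ^ p * (k * x₁ ^ p) := by
  rw [Real.div_rpow hx₂.le hx₁.le]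
  have : x₁ ^ p ≠ 0 := (Real.rpow_pos_of_pos hx₁ p).ne'
  field_simp

/-- **Upper bracket.** With non-negative amplitudes and exponents `≤ pmax`, refining the scale by the
factor `x₂/x₁ ≥ 1` multiplies the cost by at most `(x₂/x₁)^pmax`. -/
theorem mixedPowerCost_le (hk : ∀ i ∈ s, 0 ≤ k i) (hp : ∀ i ∈ s, p i ≤ pmax) (hx₁ : 0 < x₁)
    (hx : x₁ ≤ x₂) :
    mixedPowerCost s k p x₂ ≤ (x₂ / x₁) ^ pmax * mixedPowerCost s k p x₁ := by
  have hx₂ : 0 < x₂ := lt_of_lt_of_le hx₁ hx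
  have hr : 1 ≤ x₂ / x₁ := (one_le_div hx₁).mpr hx
  unfold mixedPowerCost
  rw [mul_sum]
  refine sum_le_sum fun i hi => ?_
  rw [term_eq_ratio_rpow_mul (k i) (p i) hx₁ hx₂]
  exact mul_le_mul_of_nonneg_right (Real.rpow_le_rpow_of_exponent_le hr (hp i hi))
    (mul_nonneg (hk i hi) (Real.rpow_nonneg hx₁.le _))

/-- **Lower bracket.** With non-negative amplitudes and exponents `≥ pmin`, refining the scale by
`x₂/x₁ ≥ 1` multiplies the cost by at least `(x₂/x₁)^pmin`. -/
theorem le_mixedPowerCost (hk : ∀ i ∈ s, 0 ≤ k i) (hp : ∀ i ∈ s, pmin ≤ p i) (hx₁ : 0 < x₁)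
    (hx : x₁ ≤ x₂) :
    (x₂ / x₁) ^ pmin * mixedPowerCost s k p x₁ ≤ mixedPowerCost s k p x₂ := by
  have hx₂ : 0 < x₂ := lt_of_lt_of_le hx₁ hx
  have hr : 1 ≤ x₂ / x₁ := (one_le_div hx₁).mpr hx
  unfold mixedPowerCost
  rw [mul_sum]
  refine sum_le_sum fun i hi => ?_
  rw [term_eq_ratio_rpow_mul (k i) (p i) hx₁ hx₂]
  exact mul_le_mul_of_nonneg_right (Real.rpow_le_rpow_of_exponent_le hr (hp i hi))
    (mul_nonneg (hk i hi) (Real.rpow_nonneg hx₁.le _))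

/-- The cost is non-negative for non-negative amplitudes (`x > 0`). -/
theorem mixedPowerCost_nonneg (hk : ∀ i ∈ s, 0 ≤ k i) {x : ℝ} (hx : 0 < x) :
    0 ≤ mixedPowerCost s k p x :=
  sum_nonneg fun i hi => mul_nonneg (hk i hi) (Real.rpow_nonneg hx.le _)

/-- **THE TWO-POINT EXPONENT IS BRACKETED BY THE POWERS.**  For a mixed power law with
non-negative amplitudes, exponents in `[pmin, pmax]`, positive cost at the coarser scale and
`x₁ < x₂`: `pmin ≤ secantExponent C x₁ x₂ ≤ pmax` — a fit through two spacings can only return a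
value between the smallest and the largest power present. -/
theorem secantExponent_mem_Icc (hk : ∀ i ∈ s, 0 ≤ k i) (hpmin : ∀ i ∈ s, pmin ≤ p i)
    (hpmax : ∀ i ∈ s, p i ≤ pmax) (hx₁ : 0 < x₁) (hx : x₁ < x₂)
    (hC : 0 < mixedPowerCost s k p x₁) :
    secantExponent (mixedPowerCost s k p) x₁ x₂ ∈ Set.Icc pmin pmax := by
  have hr : 1 < x₂ / x₁ := (one_lt_div hx₁).mpr hx
  have hlog : 0 < Real.log (x₂ / x₁) := Real.log_pos hr
  have hup := mixedPowerCost_le s hk hpmax hx₁ hx.le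
  have hlo := le_mixedPowerCost s hk hpmin hx₁ hx.le
  have hC₂ : 0 < mixedPowerCost s k p x₂ :=
    lt_of_lt_of_le (mul_pos (Real.rpow_pos_of_pos (lt_trans one_pos hr) _) hC) hlo
  unfold secantExponent
  constructor
  · rw [le_div_iff₀ hlog, ← Real.log_rpow (lt_trans one_pos hr)]
    exact Real.log_le_log (Real.rpow_pos_of_pos (lt_trans one_pos hr) _)
      ((le_div_iff₀ hC).mpr hlo)
  · rw [div_le_iff₀ hlog, ← Real.log_rpow (lt_trans one_pos hr)]
    exact Real.log_le_log (div_pos hC₂ hC) ((div_le_iff₀ hC).mpr hup)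

/-- Sanity: a PURE power law `C(x) = k x^p` (`k > 0`) has two-point exponent exactly `p`. -/
theorem secantExponent_pure {kk pp : ℝ} (hk : 0 < kk) (hx₁ : 0 < x₁) (hx : x₁ < x₂) :
    secantExponent (fun x => kk * x ^ pp) x₁ x₂ = pp := by
  have hx₂ : 0 < x₂ := lt_trans hx₁ hx
  have hr : 1 < x₂ / x₁ := (one_lt_div hx₁).mpr hx
  have hlog : Real.log (x₂ / x₁) ≠ 0 := (Real.log_pos hr).ne'
  unfold secantExponent
  rw [div_eq_iff hlog, ← Real.log_rpow (lt_trans one_pos hr), Real.div_rpow hx₂.le hx₁.le]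
  congr 1
  have : x₁ ^ pp ≠ 0 := (Real.rpow_pos_of_pos hx₁ pp).ne'
  field_simp

end Bracket

section Crossover

variable (s : Finset ι) {k p : ι → ℝ} {q A : ℝ}

/-- **Against a steeper competitor the ratio only falls.**  If a competitor costs `A x^q` (`A > 0`)
with `q ≥` every power of the mixed law (non-negative amplitudes), then `C(x)/(A x^q)` is antitone
on `(0, ∞)`. -/
theorem mixedPowerCost_div_antitoneOn (hk : ∀ i ∈ s, 0 ≤ k i) (hp : ∀ i ∈ s, p i ≤ q) (hA : 0 < A) :
    AntitoneOn (fun x => mixedPowerCost s k p x / (A * x ^ q)) (Set.Ioi 0) := by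
  intro x₁ hx₁ x₂ hx₂ hx
  simp only [Set.mem_Ioi] at hx₁ hx₂
  have e : ∀ x : ℝ, 0 < x → mixedPowerCost s k p x / (A * x ^ q)
      = ∑ i ∈ s, k i / A * x ^ (p i - q) := by
    intro x hx
    unfold mixedPowerCost
    rw [sum_div]
    refine sum_congr rfl fun i _ => ?_
    rw [Real.rpow_sub hx]
    have : x ^ q ≠ 0 := (Real.rpow_pos_of_pos hx q).ne'
    field_simp
  simp only []
  rw [e x₁ hx₁, e x₂ hx₂]
  refine sum_le_sum fun i hi => mul_le_mul_of_nonneg_left ?_ (div_nonneg (hk i hi) hA.le)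
  exact Real.rpow_le_rpow_of_nonpos hx₁ hx (sub_nonpos.mpr (hp i hi))

/-- Hence ONE CROSSOVER AT MOST: if the mixed law is not more expensive than the steeper
competitor at some scale `x₀ > 0`, it stays so at every finer scale `x ≥ x₀`. -/
theorem mixedPowerCost_le_competitor_of_le (hk : ∀ i ∈ s, 0 ≤ k i) (hp : ∀ i ∈ s, p i ≤ q)
    (hA : 0 < A) {x₀ x : ℝ} (hx₀ : 0 < x₀) (hx : x₀ ≤ x)
    (h₀ : mixedPowerCost s k p x₀ ≤ A * x₀ ^ q) :
    mixedPowerCost s k p x ≤ A * x ^ q := by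
  have hxpos : 0 < x := lt_of_lt_of_le hx₀ hx
  have hD₀ : 0 < A * x₀ ^ q := mul_pos hA (Real.rpow_pos_of_pos hx₀ q)
  have hD : 0 < A * x ^ q := mul_pos hA (Real.rpow_pos_of_pos hxpos q)
  have hanti := mixedPowerCost_div_antitoneOn s hk hp hA (Set.mem_Ioi.mpr hx₀)
    (Set.mem_Ioi.mpr hxpos) hx
  have h1 : mixedPowerCost s k p x₀ / (A * x₀ ^ q) ≤ 1 := (div_le_one hD₀).mpr h₀
  exact (div_le_one hD).mp (le_trans hanti h1)

end Crossover

section TwoTerms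

/-- Two terms `k₀ x^{p₀} + k₁ x^{p₁}` with `p₁ ≤ p₀`, non-negative amplitudes not both zero: every
two-point exponent lies in `[p₁, p₀]`. -/
theorem secantExponent_two_terms_mem_Icc {k₀ k₁ p₀ p₁ x₁ x₂ : ℝ} (hp : p₁ ≤ p₀) (hk₀ : 0 ≤ k₀)
    (hk₁ : 0 ≤ k₁) (hpos : 0 < k₀ + k₁) (hx₁ : 0 < x₁) (hx : x₁ < x₂) :
    secantExponent (fun x => k₀ * x ^ p₀ + k₁ * x ^ p₁) x₁ x₂ ∈ Set.Icc p₁ p₀ := by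
  have hC : (fun x => k₀ * x ^ p₀ + k₁ * x ^ p₁)
      = mixedPowerCost {0, 1} (fun i : ℕ => if i = 0 then k₀ else k₁)
          (fun i : ℕ => if i = 0 then p₀ else p₁) := by
    funext x
    simp [mixedPowerCost]
  rw [hC]
  refine secantExponent_mem_Icc {0, 1} ?_ ?_ ?_ hx₁ hx ?_
  · intro i hi; simp only [mem_insert, mem_singleton] at hi; rcases hi with rfl | rfl <;> simp [hk₀, hk₁]
  · intro i hi; simp only [mem_insert, mem_singleton] at hi; rcases hi with rfl | rfl <;> simp [hp]
  · intro i hi; simp only [mem_insert, mem_singleton] at hi; rcases hi with rfl | rfl <;> simp [hp]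
  · simp only [mixedPowerCost, sum_pair (show (0:ℕ) ≠ 1 by norm_num), if_true,
      if_neg (show (1:ℕ) ≠ 0 by norm_num)]
    have h7 := Real.rpow_pos_of_pos hx₁ p₀
    have h6 := Real.rpow_pos_of_pos hx₁ p₁
    rcases hk₀.eq_or_lt with h | h
    · have hk1 : 0 < k₁ := by rw [← h] at hpos; simpa using hpos
      have := mul_pos hk1 h6
      rw [← h, zero_mul, zero_add]
      exact this
    · have := mul_pos h h7
      have := mul_nonneg hk₁ h6.le
      linarith

/-- **E7 / row 19, protocol-step units.**  Bonanno et al.'s continuum strategy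
(arXiv:2510.25704 §5, eq. (5.2)): `n_step ∝ a^{−3}` at fixed ESS and `n_between ∝ a^{−2}` at fixed
`τ_int`, so `Eff(Q_L²) ∝ k₀ a^{−3} + k₁ a^{−2}`; in `x = 1/a` every two-spacing exponent of that law
lies in `[2, 3]`. -/
theorem e7_secantExponent_stepUnits {k₀ k₁ x₁ x₂ : ℝ} (hk₀ : 0 ≤ k₀) (hk₁ : 0 ≤ k₁)
    (hpos : 0 < k₀ + k₁) (hx₁ : 0 < x₁) (hx : x₁ < x₂) :
    secantExponent (fun x => k₀ * x ^ (3 : ℝ) + k₁ * x ^ (2 : ℝ)) x₁ x₂ ∈ Set.Icc (2 : ℝ) 3 :=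
  secantExponent_two_terms_mem_Icc (by norm_num) hk₀ hk₁ hpos hx₁ hx

/-- **E7 / row 19, link-update (core-second) units at fixed physical volume**: each protocol step
and each `n_between` sweep is a full-lattice sweep `∝ a^{−4}`, so the cost per effectively
independent measurement is `k₀ x^7 + k₁ x^6` and every two-spacing exponent lies in `[6, 7]` —
to be set against a local algorithm whose `τ_int(Q²)` grows like `a^{−z}`, cost `∝ x^{4+z}`. -/
theorem e7_secantExponent_linkUnits {k₀ k₁ x₁ x₂ : ℝ} (hk₀ : 0 ≤ k₀) (hk₁ : 0 ≤ k₁)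
    (hpos : 0 < k₀ + k₁) (hx₁ : 0 < x₁) (hx : x₁ < x₂) :
    secantExponent (fun x => k₀ * x ^ (7 : ℝ) + k₁ * x ^ (6 : ℝ)) x₁ x₂ ∈ Set.Icc (6 : ℝ) 7 :=
  secantExponent_two_terms_mem_Icc (by norm_num) hk₀ hk₁ hpos hx₁ hx

/-- … and against such a local algorithm with `z ≥ 3` (`q = 4 + z ≥ 7`) there is at most one
crossover: once family C is not more expensive at some spacing, it stays so at every finer one. -/
theorem e7_le_competitor_of_le {k₀ k₁ A q x₀ x : ℝ} (hk₀ : 0 ≤ k₀) (hk₁ : 0 ≤ k₁) (hq : 7 ≤ q)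
    (hA : 0 < A) (hx₀ : 0 < x₀) (hx : x₀ ≤ x)
    (h₀ : k₀ * x₀ ^ (7 : ℝ) + k₁ * x₀ ^ (6 : ℝ) ≤ A * x₀ ^ q) :
    k₀ * x ^ (7 : ℝ) + k₁ * x ^ (6 : ℝ) ≤ A * x ^ q := by
  have hC : ∀ y : ℝ, k₀ * y ^ (7 : ℝ) + k₁ * y ^ (6 : ℝ)
      = mixedPowerCost {0, 1} (fun i : ℕ => if i = 0 then k₀ else k₁)
          (fun i : ℕ => if i = 0 then 7 else 6) y := by
    intro y
    simp [mixedPowerCost]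
  rw [hC] at h₀ ⊢
  refine mixedPowerCost_le_competitor_of_le {0, 1} ?_ ?_ hA hx₀ hx h₀
  · intro i hi; simp only [mem_insert, mem_singleton] at hi; rcases hi with rfl | rfl <;> simp [hk₀, hk₁]
  · intro i hi; simp only [mem_insert, mem_singleton] at hi; rcases hi with rfl | rfl <;> simp <;>
      linarith

end TwoTerms

end Summit.Ventures.LatticeQCDFlow.Scaling
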